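import Literature.MathematicalPhysics.QuantumLattice.MatrixProductStates
import HarnessLib

/-!
# Discharged fact: the AKLT tensor is normal (`MatrixProductStates`)

Sibling proof file of `Literature/MathematicalPhysics/QuantumLattice/MatrixProductStates.lean`
(the first is `MatrixProductStatesProofs.lean`). It discharges the named fact (`def X : Prop`,
D-0014)

* `Literature.MathematicalPhysics.QuantumLattice.isNormalMPS_akltTensor` — *the AKLT tensor is
  normal* (`isNormalMPS_akltTensor_holds`), indeed injective with block length `2`
  (`isInjectiveMPS_akltTensor_two`);

no statement or definition is introduced or changed.

## Source

Fannes–Nachtergaele–Werner, CMP **144** (1992). By Def. 5.4 (p. 468) the *interaction length*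
`ℓ₀` of a purely generated finitely correlated state is the least `ℓ` for which
`Γ_ℓ : B ↦ Σ_μ ψ_{μ₁} ⊗ ⋯ ⊗ ψ_{μ_ℓ} Tr(B v(μ_ℓ)* ⋯ v(μ₁)*)` (eq. (5.5), p. 465) has full rank
`k²`, i.e. is injective, i.e. for which the words `v(μ₁) ⋯ v(μ_ℓ)` of length `ℓ` span the bond
algebra `M_k` (this is `IsInjectiveMPS A ℓ`); Example 7 (p. 473) shows "for our family of models
the interaction length `ℓ₀ = 2`" for the whole family `ω_θ`, `cos θ sin θ ≠ 0`, which contains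
the AKLT state at `cos θ = √(2/3)` (Example 1, p. 451; Example 3, p. 455).

## Proof

For the vendored tensor (`A⁺ = √(2/3) σ⁺`, `A⁰ = -√(1/3) σᶻ`, `A⁻ = -√(2/3) σ⁻`, physical
index `k ↦ m = 1 - k`, Schollwöck's gauge) this is a direct `2 × 2` computation: the products
along the words `(+,−)`, `(−,+)`, `(+,0)`, `(−,0)` are
`A⁺A⁻ = -(2/3) E₀₀`, `A⁻A⁺ = -(2/3) E₁₁`, `A⁺A⁰ = (√2/3) E₀₁`, `A⁻A⁰ = (√2/3) E₁₀`,
nonzero multiples of the four matrix units, so the nine words of length `2` span `M₂(ℂ)`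
(`isInjectiveMPS_akltTensor_two`), and `2 > 0` witnesses `IsNormalMPS`
(`isNormalMPS_akltTensor_holds`). Length `1` does not suffice — `A⁺, A⁰, A⁻` span only the
`3`-dimensional space `span {σ⁺, σᶻ, σ⁻} ∌ 𝟙` — consistent with `ℓ₀ = 2`.

## References

* M. Fannes, B. Nachtergaele, R. F. Werner, *Finitely correlated states on quantum spin chains*,
  Comm. Math. Phys. **144** (1992) 443–490, doi:10.1007/bf02099178, §5 eq. (5.5), Def. 5.4,
  Examples 1, 3, 7.
* U. Schollwöck, *The density-matrix renormalization group in the age of matrix product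
  states*, Ann. Phys. **326** (2011) 96–192, §4.1.5 (the AKLT tensor in this gauge).
-/

noncomputable section

open Matrix

namespace Literature.MathematicalPhysics.QuantumLattice

section QLattice

variable {q D : ℕ}

/-! ### The AKLT tensor is normal -/

/-- A word product of length `2` is the two-letter product `A^{w₀} A^{w₁}`. [folklore] -/
theorem wordProduct_fin_two (A : MPSTensor q D) (w : Fin 2 → Fin q) :
    wordProduct A w = A (w 0) * A (w 1) := by
  simp [wordProduct, List.ofFn_succ]

/-- **The AKLT tensor is injective with block length `2`**: the nine products `A^i A^j` span
`M₂(ℂ)`. Indeed `A⁺A⁻ = -(2/3) E₀₀`, `A⁻A⁺ = -(2/3) E₁₁`, `A⁺A⁰ = (√2/3) E₀₁` and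
`A⁻A⁰ = (√2/3) E₁₀` are nonzero multiples of the four matrix units. This is the statement
`ℓ₀ = 2` of Fannes–Nachtergaele–Werner (1992), Example 7 (p. 473), at the AKLT point
`cos θ = √(2/3)` of their family `ω_θ` (Example 1, p. 451), `ℓ₀` being the interaction length of
Def. 5.4 (p. 468): the least `ℓ` for which `Γ_ℓ` (eq. (5.5)) is injective, i.e. for which the
words of length `ℓ` span the bond algebra.
[cite: FannesNachtergaeleWernerCMP1992, §5 Def. 5.4 and Example 7 (p. 473)] -/
theorem isInjectiveMPS_akltTensor_two : IsInjectiveMPS akltTensor 2 := by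
  unfold IsInjectiveMPS
  set S : Submodule ℂ (Matrix (Fin 2) (Fin 2) ℂ) :=
    Submodule.span ℂ (Set.range (wordProduct (ℓ := 2) akltTensor))
  -- the scalars `√(2/3)`, `√(1/3)` (as complex numbers) are nonzero
  have ha : ((Real.sqrt (2 / 3) : ℝ) : ℂ) ≠ 0 :=
    Complex.ofReal_ne_zero.2 (Real.sqrt_ne_zero'.2 (by norm_num))
  have hb : ((Real.sqrt (1 / 3) : ℝ) : ℂ) ≠ 0 :=
    Complex.ofReal_ne_zero.2 (Real.sqrt_ne_zero'.2 (by norm_num))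
  -- every two-letter product is a word of length `2`, hence lies in `S`
  have hmem : ∀ i j : Fin 3, akltTensor i * akltTensor j ∈ S := fun i j =>
    Submodule.subset_span ⟨![i, j], by simp [wordProduct_fin_two]⟩
  -- the products along `(+,-)`, `(-,+)`, `(+,0)`, `(-,0)` are multiples of the matrix units
  have h00 : akltTensor 0 * akltTensor 2 =
      (-(((Real.sqrt (2 / 3) : ℝ) : ℂ) * ((Real.sqrt (2 / 3) : ℝ) : ℂ))) • !![1, 0; 0, 0] := by
    ext i j
    fin_cases i <;> fin_cases j <;> simp [akltTensor, Matrix.mul_apply, Fin.sum_univ_two]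
  have h11 : akltTensor 2 * akltTensor 0 =
      (-(((Real.sqrt (2 / 3) : ℝ) : ℂ) * ((Real.sqrt (2 / 3) : ℝ) : ℂ))) • !![0, 0; 0, 1] := by
    ext i j
    fin_cases i <;> fin_cases j <;> simp [akltTensor, Matrix.mul_apply, Fin.sum_univ_two]
  have h01 : akltTensor 0 * akltTensor 1 =
      (((Real.sqrt (2 / 3) : ℝ) : ℂ) * ((Real.sqrt (1 / 3) : ℝ) : ℂ)) • !![0, 1; 0, 0] := by
    ext i j
    fin_cases i <;> fin_cases j <;> simp [akltTensor, Matrix.mul_apply, Fin.sum_univ_two]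
  have h10 : akltTensor 2 * akltTensor 1 =
      (((Real.sqrt (2 / 3) : ℝ) : ℂ) * ((Real.sqrt (1 / 3) : ℝ) : ℂ)) • !![0, 0; 1, 0] := by
    ext i j
    fin_cases i <;> fin_cases j <;> simp [akltTensor, Matrix.mul_apply, Fin.sum_univ_two]
  -- hence the four matrix units lie in `S` (divide by the nonzero scalar)
  have e00 : (!![1, 0; 0, 0] : Matrix (Fin 2) (Fin 2) ℂ) ∈ S := by
    have h := hmem 0 2
    rw [h00] at h
    exact (S.smul_mem_iff (neg_ne_zero.2 (mul_ne_zero ha ha))).1 h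
  have e11 : (!![0, 0; 0, 1] : Matrix (Fin 2) (Fin 2) ℂ) ∈ S := by
    have h := hmem 2 0
    rw [h11] at h
    exact (S.smul_mem_iff (neg_ne_zero.2 (mul_ne_zero ha ha))).1 h
  have e01 : (!![0, 1; 0, 0] : Matrix (Fin 2) (Fin 2) ℂ) ∈ S := by
    have h := hmem 0 1
    rw [h01] at h
    exact (S.smul_mem_iff (mul_ne_zero ha hb)).1 h
  have e10 : (!![0, 0; 1, 0] : Matrix (Fin 2) (Fin 2) ℂ) ∈ S := by
    have h := hmem 2 1
    rw [h10] at h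
    exact (S.smul_mem_iff (mul_ne_zero ha hb)).1 h
  -- and every `2 × 2` matrix is a combination of the matrix units
  refine Submodule.eq_top_iff'.2 fun x => ?_
  have hx : x = x 0 0 • !![1, 0; 0, 0] + x 0 1 • !![0, 1; 0, 0] + x 1 0 • !![0, 0; 1, 0] +
      x 1 1 • !![0, 0; 0, 1] := by
    ext i j
    fin_cases i <;> fin_cases j <;> simp
  rw [hx]
  exact add_mem (add_mem (add_mem (S.smul_mem _ e00) (S.smul_mem _ e01)) (S.smul_mem _ e10))
    (S.smul_mem _ e11)

/-- **Discharge of `isNormalMPS_akltTensor`.** The AKLT tensor is normal: it is injective with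
the positive block length `2` (`isInjectiveMPS_akltTensor_two`) — the interaction length
`ℓ₀ = 2` of Fannes–Nachtergaele–Werner (1992), Def. 5.4 (p. 468) and Example 7 (p. 473), at
the AKLT point `cos θ = √(2/3)` of Example 1 (p. 451).
[cite: FannesNachtergaeleWernerCMP1992, §5 Def. 5.4 and Example 7 (p. 473)] -/
theorem isNormalMPS_akltTensor_holds : isNormalMPS_akltTensor :=
  ⟨2, two_pos, isInjectiveMPS_akltTensor_two⟩

end QLattice

end Literature.MathematicalPhysics.QuantumLattice
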